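import Summits.AnomalousDissipation.AnomalousDissipation.Theorems.LaminarNeverLoud.Negative.StokesArc

/-!
# Negative knowledge for the crux `LaminarNeverLoud` (stmt-AnomalousDissipation-2988): V, kill shape and the isolation principle

Certified copy of §5 of the cdisprove work file `Cruxes/LaminarNeverLoud/Disproof.lean`.  Supports
stmt-AnomalousDissipation-2988.  THE EXACT SHAPE OF A KILL (`not_laminarNeverLoud_iff`: one force, one budget pair, loud
bounded laminar steady Galerkin states below every viscosity threshold); monotonicity of the admissible thresholds in
`ν₀`, `E`, `ε`; the topological lemma `connectedComponentIn_eq_of_isolated` (a relatively clopen preconnected piece of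
`V` is the component of each of its points); the Stokes arc as a set (`stokesArc`), closed for `a ≠ 0`
(`isClosed_stokesArc`: it runs to infinite energy as `ν → 0⁺`); and THE ISOLATION PRINCIPLE `admissible_of_isolated`:
if at every resolution the Stokes arc of the shear force is isolated in `V_N` (no steady bifurcation from the laminar
state at any `ν > 0`) and steady states are unique at large `ν` (fixed `N`), the laminar component IS the arc and the
crux's conclusion holds for that force with `ν₀² = a²/(8π⁴m⁴E)`.  For the gravest Kolmogorov force on the cubic torus
isolation is the finite-resolution form of the linear stability of the laminar flow at every Reynolds number
(van Veen–Goto 2016, arXiv:1512.02570, §2.2), so counterexamples to the crux need forces whose laminar branch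
bifurcates, with genuinely three-dimensional secondary states (planar ones are quiet, file IV).
-/

noncomputable section

namespace Summit.AnomalousDissipation.AnomalousDissipation.Theorems.LaminarNeverLoud.Negative

open MeasureTheory Set Filter Topology UnitAddTorus
open scoped InnerProductSpace
open Literature.Analysis.FluidPDE Literature.Analysis.FluidPDE.Torus
open Literature.Analysis.FunctionSpaces Literature.Analysis.FunctionSpaces.Torus
-- (migrate 2026-08-19) former `open …Theses.MirrorVariety (LaminarNeverLoud)` removed: the crux (item 2988, dropped at
-- rev 14) is the verbatim `@[conjecture] def Negative.LaminarNeverLoud` of `PowerBudget.lean`; no statement changed.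

variable {d : Type*} [Fintype d] [DecidableEq d]

/-! ## §5 The exact shape of a kill; monotonicity; the ISOLATION PRINCIPLE (non-bifurcating forces are safe)

A kill of the crux is one force and one budget pair with loud bounded LAMINAR points at arbitrarily small
viscosity (`not_laminarNeverLoud_iff`).  If the Stokes arc of the shear force is ISOLATED in `V_N` (no steady
bifurcation from the laminar state at any `ν > 0`, at resolution `N`) and steady states are unique at large `ν`
(fixed `N`; standard), the laminar component of `V_N` IS the arc, and the crux's conclusion holds for that force
with the explicit threshold `ν_E = |a|/(2√2π²m²√E)` (`admissible_of_isolated`).  For the gravest Kolmogorov force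
on the cubic torus the laminar flow is linearly stable at every Reynolds number (van Veen–Goto 2016 = VanVeenGoto2016,
arXiv:1512.02570, §2.2: Squire + energy method; Marchioro 1986 in 2-D), the turbulent states sitting on
saddle-node isolas ("subcritical transition") — exactly the isolation hypothesis, so a counterexample must use a
force whose laminar branch bifurcates (Kolmogorov `m ≥ 2`, Taylor–Green, ABC) AND, by §4, genuinely
three-dimensional secondary states (the primary Kolmogorov pitchforks are planar, hence quiet). -/

section Shape

/-- **EXACT SHAPE OF A KILL**: `¬ LaminarNeverLoud` iff some smooth solenoidal mean-free force and budgets `E`,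
`ε > 0` admit, below every viscosity threshold, a resolution and a LOUD BOUNDED LAMINAR steady Galerkin state. [folklore] -/
theorem not_laminarNeverLoud_iff : ¬ LaminarNeverLoud ↔
    ∃ f : UnitAddTorus (Fin 3) → EuclideanSpace ℝ (Fin 3), IsSmooth f ∧ IsDivFree f ∧ HasZeroMean f ∧
      ∃ E ε : ℝ, 0 < ε ∧ ∀ ν₀ : ℝ, 0 < ν₀ → ∃ N : ℕ,
        ∃ z ∈ steadySet (modes (Fin 3) N) (forceCoeff (modes (Fin 3) N) f),
          z ∈ laminarSet (steadySet (modes (Fin 3) N) (forceCoeff (modes (Fin 3) N) f)) ∧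
            0 < z.2 ∧ z.2 < ν₀ ∧ energy z.1 ≤ E ∧ ε ≤ dissipation z.2 z.1 := by
  rw [laminarNeverLoud_iff]
  constructor
  · intro h
    by_contra hne
    apply h
    intro f hf hdiv hmean E ε hε
    by_contra hno
    apply hne
    refine ⟨f, hf, hdiv, hmean, E, ε, hε, fun ν₀ hν₀ => ?_⟩
    by_contra hN
    apply hno
    refine ⟨ν₀, fun N z hz hlam hpos hlt hE => ?_, hν₀⟩
    by_contra hd
    exact hN ⟨N, z, hz, hlam, hpos, hlt, hE, not_lt.1 hd⟩
  · rintro ⟨f, hf, hdiv, hmean, E, ε, hε, H⟩ h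
    obtain ⟨ν₀, hadm, hν₀⟩ := h f hf hdiv hmean E ε hε
    obtain ⟨N, z, hz, hlam, hpos, hlt, hE, hloud⟩ := H ν₀ hν₀
    exact absurd (hadm N z hz hlam hpos hlt hE) (not_lt.2 hloud)

/-- Admissible thresholds are downward closed, [folklore] -/
theorem admissible_of_le {f : UnitAddTorus (Fin 3) → EuclideanSpace ℝ (Fin 3)} {E ε ν₀ ν₀' : ℝ}
    (h : ν₀ ∈ admissibleSet f E ε) (hle : ν₀' ≤ ν₀) : ν₀' ∈ admissibleSet f E ε :=
  fun N z hz hlam hpos hlt hE => h N z hz hlam hpos (hlt.trans_le hle) hE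

/-- monotone in the energy budget, [folklore] -/
theorem admissible_of_energy_le {f : UnitAddTorus (Fin 3) → EuclideanSpace ℝ (Fin 3)} {E E' ε ν₀ : ℝ}
    (h : ν₀ ∈ admissibleSet f E ε) (hle : E' ≤ E) : ν₀ ∈ admissibleSet f E' ε :=
  fun N z hz hlam hpos hlt hE => h N z hz hlam hpos hlt (hE.trans hle)

/-- and monotone in the dissipation floor. [folklore] -/
theorem admissible_of_le_eps {f : UnitAddTorus (Fin 3) → EuclideanSpace ℝ (Fin 3)} {E ε ε' ν₀ : ℝ}
    (h : ν₀ ∈ admissibleSet f E ε) (hle : ε ≤ ε') : ν₀ ∈ admissibleSet f E ε' :=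
  fun N z hz hlam hpos hlt hE => (h N z hz hlam hpos hlt hE).trans_le hle

/-- **Components of isolated pieces**: if `A ⊆ V` is preconnected, relatively open in `V` (`U ∩ V ⊆ A ⊆ U`, `U` open)
and relatively closed in `V` (`K ∩ V ⊆ A ⊆ K`, `K` closed), then `A` is the connected component in `V` of each of
its points. [folklore] -/
theorem connectedComponentIn_eq_of_isolated {X : Type*} [TopologicalSpace X] {V A U K : Set X}
    (hA : IsPreconnected A) (hAV : A ⊆ V) (hU : IsOpen U) (hAU : A ⊆ U) (hUV : U ∩ V ⊆ A)
    (hK : IsClosed K) (hAK : A ⊆ K) (hKV : K ∩ V ⊆ A) {z : X} (hz : z ∈ A) :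
    connectedComponentIn V z = A := by
  refine Subset.antisymm ?_ (hA.subset_connectedComponentIn hz hAV)
  set C := connectedComponentIn V z
  have hC : IsPreconnected C := isPreconnected_connectedComponentIn
  have hCV : C ⊆ V := connectedComponentIn_subset V z
  have hzC : z ∈ C := mem_connectedComponentIn (hAV hz)
  -- cover `C` by the open sets `U` and `Kᶜ`
  have hcover : C ⊆ U ∪ Kᶜ := by
    intro x hx
    by_cases hxU : x ∈ U
    · exact Or.inl hxU
    · refine Or.inr fun hxK => hxU (hAU (hKV ⟨hxK, hCV hx⟩))
  by_contra hnot
  obtain ⟨x, hxC, hxA⟩ := Set.not_subset.1 hnot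
  have hxK : x ∈ Kᶜ := fun hxK => hxA (hKV ⟨hxK, hCV hxC⟩)
  obtain ⟨y, hyC, hyU, hyK⟩ := hC U Kᶜ hU hK.isOpen_compl hcover ⟨z, hzC, hAU hz⟩ ⟨x, hxC, hxK⟩
  exact hyK (hAK (hUV ⟨hyU, hCV hyC⟩))

end Shape

section Isolation

variable {S : Finset (Fin 3 → ℤ)} {m : ℤ}

/-- The Stokes arc of the shear force on the frequency set `S`: `{stokesPoint μ | μ > 0}`. [folklore] -/
def stokesArc (S : Finset (Fin 3 → ℤ)) (m : ℤ) (a : ℝ) : Set ((↥S → EuclideanSpace ℂ (Fin 3)) × ℝ) :=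
  (fun μ : ℝ => stokesPoint S m a μ) '' Ioi 0

/-- The Stokes arc is preconnected, [folklore] -/
theorem isPreconnected_stokesArc (S : Finset (Fin 3 → ℤ)) (hm : m ≠ 0) (a : ℝ) :
    IsPreconnected (stokesArc S m a) :=
  isPreconnected_Ioi.image _ (continuousOn_stokesPoint S hm a)

/-- lies on the variety, [folklore] -/
theorem stokesArc_subset (hp : kol m ∈ S) (hn : -kol m ∈ S) (hm : m ≠ 0) (a : ℝ) :
    stokesArc S m a ⊆ steadySet S (shearVec S m a) := by
  rintro _ ⟨μ, hμ, rfl⟩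
  exact stokesPoint_mem hp hn hm a (ne_of_gt hμ)

/-- and is described by the equation `c = (a/(4π²νm²)) • shearVec 1`, `ν > 0`. [folklore] -/
theorem mem_stokesArc_iff (S : Finset (Fin 3 → ℤ)) (m : ℤ) (a : ℝ) (z : (↥S → EuclideanSpace ℂ (Fin 3)) × ℝ) :
    z ∈ stokesArc S m a ↔ 0 < z.2 ∧
      z.1 = (((a / (4 * Real.pi ^ 2 * z.2 * (m : ℝ) ^ 2)) : ℝ) : ℂ) • shearVec S m 1 := by
  constructor
  · rintro ⟨μ, hμ, rfl⟩
    refine ⟨hμ, ?_⟩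
    show shearVec S m (a / (4 * Real.pi ^ 2 * μ * (m : ℝ) ^ 2)) =
      (((a / (4 * Real.pi ^ 2 * μ * (m : ℝ) ^ 2)) : ℝ) : ℂ) • shearVec S m 1
    exact shearVec_eq_smul S m _
  · rintro ⟨hpos, heq⟩
    refine ⟨z.2, hpos, ?_⟩
    rw [← shearVec_eq_smul S m] at heq
    show (shearVec S m (a / (4 * Real.pi ^ 2 * z.2 * (m : ℝ) ^ 2)), z.2) = z
    exact Prod.ext heq.symm rfl

/-- The direction vector `shearVec S m 1` has sup norm `≥ 1` when the shear mode is in `S`. [folklore] -/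
theorem one_le_norm_shearVec_one (hp : kol m ∈ S) : 1 ≤ ‖shearVec S m (1 : ℝ)‖ := by
  have h := norm_le_pi_norm (shearVec S m (1 : ℝ)) ⟨kol m, hp⟩
  have h1 : ‖shearVec S m (1 : ℝ) ⟨kol m, hp⟩‖ = 1 := by
    show ‖shearCoeff m 1 (kol m)‖ = 1
    rw [shearCoeff_of_shear 1 (Or.inl rfl), norm_smul,
      show ‖e0‖ = 1 by rw [e0, EuclideanSpace.norm_complexify, PiLp.norm_single, norm_one], Complex.ofReal_one,
      norm_one, one_mul]
  linarith

/-- **The Stokes arc is closed** (for `a ≠ 0`): it runs to infinite energy as `ν → 0⁺`, so it has no limit point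
on `ν = 0`. [folklore] -/
theorem isClosed_stokesArc (hp : kol m ∈ S) (hm : m ≠ 0) {a : ℝ} (ha : a ≠ 0) :
    IsClosed (stokesArc S m a) := by
  set D : ↥S → EuclideanSpace ℂ (Fin 3) := shearVec S m 1 with hD
  set b : ℝ → ℝ := fun μ => a / (4 * Real.pi ^ 2 * μ * (m : ℝ) ^ 2) with hb
  have hm' : (m : ℝ) ≠ 0 := Int.cast_ne_zero.2 hm
  have hDpos : 1 ≤ ‖D‖ := one_le_norm_shearVec_one hp
  rw [← isOpen_compl_iff, isOpen_iff_forall_mem_open]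
  intro z hz
  rcases lt_trichotomy z.2 0 with hneg | hzero | hpos
  · -- `ν < 0`: the open half-space misses the arc
    refine ⟨{w | w.2 < 0}, fun w hw hwA => ?_, isOpen_lt continuous_snd continuous_const, hneg⟩
    exact absurd ((mem_stokesArc_iff S m a w).1 hwA).1 (not_lt.2 (le_of_lt hw))
  · -- `ν = 0`: arc points with small `ν` have huge norm
    set R : ℝ := ‖z.1‖ + 1 with hR
    have hRpos : 0 < R := by positivity
    -- choose `δ > 0` with `|a|/(4π²δm²) ≥ R`, i.e. `δ = |a|/(4π²m²R)`
    set δ : ℝ := |a| / (4 * Real.pi ^ 2 * (m : ℝ) ^ 2 * R) with hδ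
    have hδpos : 0 < δ := by positivity
    refine ⟨{w | w.2 < δ ∧ ‖w.1‖ < R}, fun w hw hwA => ?_,
      (isOpen_lt continuous_snd continuous_const).inter (isOpen_lt (continuous_norm.comp continuous_fst)
        continuous_const), ⟨by rw [hzero]; exact hδpos, by simp [hR]⟩⟩
    obtain ⟨hwpos, hweq⟩ := (mem_stokesArc_iff S m a w).1 hwA
    have hnorm : ‖w.1‖ = |b w.2| * ‖D‖ := by
      rw [hweq, norm_smul, Complex.norm_real, Real.norm_eq_abs]
    -- `|b w.2| ≥ |a|/(4π² δ m²) = R` since `w.2 < δ`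
    have hbge : R ≤ |b w.2| := by
      rw [hb]
      dsimp only
      rw [abs_div, abs_of_pos (by positivity : (0 : ℝ) < 4 * Real.pi ^ 2 * w.2 * (m : ℝ) ^ 2),
        le_div_iff₀ (by positivity)]
      have h1 : w.2 ≤ δ := le_of_lt hw.1
      calc R * (4 * Real.pi ^ 2 * w.2 * (m : ℝ) ^ 2) ≤ R * (4 * Real.pi ^ 2 * δ * (m : ℝ) ^ 2) := by
            gcongr
        _ = |a| := by rw [hδ]; field_simp
    have : R ≤ ‖w.1‖ := by
      rw [hnorm]
      calc R ≤ |b w.2| := hbge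
        _ = |b w.2| * 1 := (mul_one _).symm
        _ ≤ |b w.2| * ‖D‖ := mul_le_mul_of_nonneg_left hDpos (abs_nonneg _)
    exact absurd hw.2 (not_lt.2 this)
  · -- `ν > 0` off the arc: `c ≠ b(ν) • D`, an open condition on `{ν > 0}`
    have hne : z.1 ≠ ((b z.2 : ℝ) : ℂ) • D := fun h => hz ((mem_stokesArc_iff S m a z).2 ⟨hpos, h⟩)
    have hcont : ContinuousOn (fun w : (↥S → EuclideanSpace ℂ (Fin 3)) × ℝ => w.1 - ((b w.2 : ℝ) : ℂ) • D)
        {w | 0 < w.2} := by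
      refine continuousOn_fst.sub ((Complex.continuous_ofReal.comp_continuousOn ?_).smul continuousOn_const)
      rw [hb]
      refine continuousOn_const.div (by fun_prop) fun w hw => ?_
      have : (0 : ℝ) < w.2 := hw
      positivity
    have hopen : IsOpen {w : (↥S → EuclideanSpace ℂ (Fin 3)) × ℝ | 0 < w.2} :=
      isOpen_lt continuous_const continuous_snd
    obtain ⟨O, hO, hOeq⟩ := (continuousOn_iff'.1 hcont) {v | v ≠ 0} isOpen_ne
    refine ⟨O ∩ {w | 0 < w.2}, fun w hw hwA => ?_, hO.inter hopen, ?_⟩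
    · obtain ⟨hwpos, hweq⟩ := (mem_stokesArc_iff S m a w).1 hwA
      have hw' : w ∈ (fun w : (↥S → EuclideanSpace ℂ (Fin 3)) × ℝ => w.1 - ((b w.2 : ℝ) : ℂ) • D) ⁻¹' {v | v ≠ 0} ∩
          {w | 0 < w.2} := by rw [hOeq]; exact hw
      exact hw'.1 (sub_eq_zero.2 hweq)
    · have hz' : z ∈ (fun w : (↥S → EuclideanSpace ℂ (Fin 3)) × ℝ => w.1 - ((b w.2 : ℝ) : ℂ) • D) ⁻¹' {v | v ≠ 0} ∩
          {w | 0 < w.2} := ⟨sub_ne_zero.2 hne, hpos⟩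
      rw [hOeq] at hz'
      exact hz'

/-- On the Stokes arc, bounded energy forces the viscosity up: `energy ≤ E` at `stokesPoint ν`, `ν > 0`, implies
`|a|/(2√2 π² m² √E) ≤ ν` — equivalently `a² ≤ 8π⁴m⁴ν²E`. [folklore] -/
theorem sq_le_of_energy_stokesPoint_le (hp : kol m ∈ S) (hn : -kol m ∈ S) (hm : m ≠ 0) (a : ℝ) {ν E : ℝ}
    (hν : 0 < ν) (hE : energy (stokesPoint S m a ν).1 ≤ E) :
    a ^ 2 ≤ 8 * Real.pi ^ 4 * (m : ℝ) ^ 4 * ν ^ 2 * E := by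
  rw [energy_stokesPoint hp hn hm] at hE
  have hm' : (m : ℝ) ≠ 0 := Int.cast_ne_zero.2 hm
  have h : 2 * (a / (4 * Real.pi ^ 2 * ν * (m : ℝ) ^ 2)) ^ 2 = a ^ 2 / (8 * Real.pi ^ 4 * (m : ℝ) ^ 4 * ν ^ 2) := by
    field_simp; ring
  rw [h, div_le_iff₀ (by positivity)] at hE
  linarith

/-- **THE ISOLATION PRINCIPLE** (non-bifurcating forces satisfy the crux).  Let `m ≠ 0`, `a ≠ 0`.  Suppose that at
every resolution `N ≥ |m|` (i) the Stokes arc is ISOLATED in `V_N` — some open `U ⊇ arc` has `U ∩ V_N ⊆ arc` (no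
steady bifurcation from the laminar state at any `ν > 0`) — and (ii) steady Galerkin states are unique beyond some
`ν₁(N)` (`V_N ∩ {ν > ν₁} ⊆ arc`; standard at fixed `N`).  Then for all budgets `E`, `ε > 0` the shear force
`2a cos(2π m x₁)e₀` HAS a positive admissible threshold, namely `ν₀` with `ν₀² = a²/(8π⁴m⁴E)` when `E > 0`: below it
the laminar component carries no bounded point at all.  (For the gravest Kolmogorov force on the cubic torus (i) is the
finite-resolution form of the linear stability of the laminar flow at all Reynolds numbers, van Veen–Goto 2016 §2.2.)
[cite: VanVeenGoto2016, §2.2 and §4] -/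
theorem admissible_of_isolated (hm : m ≠ 0) {a : ℝ} (ha : a ≠ 0)
    (hiso : ∀ N : ℕ, m.natAbs ≤ N → ∃ U : Set ((↥(modes (Fin 3) N) → EuclideanSpace ℂ (Fin 3)) × ℝ),
      IsOpen U ∧ stokesArc (modes (Fin 3) N) m a ⊆ U ∧
        U ∩ steadySet (modes (Fin 3) N) (shearVec (modes (Fin 3) N) m a) ⊆ stokesArc (modes (Fin 3) N) m a)
    (huniq : ∀ N : ℕ, m.natAbs ≤ N → ∃ ν₁ : ℝ, ∀ z ∈ steadySet (modes (Fin 3) N) (shearVec (modes (Fin 3) N) m a),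
      ν₁ < z.2 → z ∈ stokesArc (modes (Fin 3) N) m a)
    {E ε : ℝ} (hE : 0 < E) (hε : 0 < ε) :
    ∃ ν₀ ∈ admissibleSet (shearForce m a) E ε, 0 < ν₀ ∧ ν₀ ^ 2 = a ^ 2 / (8 * Real.pi ^ 4 * (m : ℝ) ^ 4 * E) := by
  have hm' : (m : ℝ) ≠ 0 := Int.cast_ne_zero.2 hm
  set ν₀ : ℝ := |a| / (Real.sqrt (8 * Real.pi ^ 4 * (m : ℝ) ^ 4 * E)) with hν₀
  have hrad : 0 < 8 * Real.pi ^ 4 * (m : ℝ) ^ 4 * E := by positivity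
  have hν₀pos : 0 < ν₀ := div_pos (abs_pos.2 ha) (Real.sqrt_pos.2 hrad)
  have hν₀sq : ν₀ ^ 2 = a ^ 2 / (8 * Real.pi ^ 4 * (m : ℝ) ^ 4 * E) := by
    rw [hν₀, div_pow, sq_abs, Real.sq_sqrt hrad.le]
  refine ⟨ν₀, fun N z hz hlam hpos hlt hzE => ?_, hν₀pos, hν₀sq⟩
  -- either the shear modes are unresolved (then every steady state is powerless) or the principle applies
  by_cases hN : m.natAbs ≤ N
  · exfalso
    have hp : kol m ∈ modes (Fin 3) N := kol_mem_modes hm hN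
    have hn : -kol m ∈ modes (Fin 3) N := neg_kol_mem_modes hm hN
    rw [forceCoeff_shearForce] at hz hlam
    obtain ⟨U, hU, hAU, hUV⟩ := hiso N hN
    obtain ⟨ν₁, hν₁⟩ := huniq N hN
    -- the component of `z` reaches beyond `ν₁`, hence meets the arc, hence IS the arc
    obtain ⟨z', hz'C, hz'big⟩ := hlam (max ν₁ 0 + 1)
    have hz'V : z' ∈ steadySet (modes (Fin 3) N) (shearVec (modes (Fin 3) N) m a) :=
      connectedComponentIn_subset _ _ hz'C
    have hz'A : z' ∈ stokesArc (modes (Fin 3) N) m a :=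
      hν₁ z' hz'V (by linarith [le_max_left ν₁ 0])
    have hcomp : connectedComponentIn (steadySet (modes (Fin 3) N) (shearVec (modes (Fin 3) N) m a)) z' =
        stokesArc (modes (Fin 3) N) m a :=
      connectedComponentIn_eq_of_isolated (isPreconnected_stokesArc _ hm a) (stokesArc_subset hp hn hm a) hU hAU
        hUV (isClosed_stokesArc hp hm ha) Subset.rfl (fun w hw => hw.1) hz'A
    have hzA : z ∈ stokesArc (modes (Fin 3) N) m a := by
      rw [← hcomp, ← connectedComponentIn_eq hz'C]
      exact mem_connectedComponentIn hz
    -- on the arc, bounded energy forces `ν ≥ ν₀`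
    obtain ⟨μ, hμ, hzμ⟩ := hzA
    have hzμ' : stokesPoint (modes (Fin 3) N) m a μ = z := hzμ
    have hμν : μ = z.2 := by rw [← hzμ', stokesPoint_snd]
    have hsq := sq_le_of_energy_stokesPoint_le (E := E) hp hn hm a hμ (by rw [hzμ']; exact hzE)
    rw [hμν] at hsq
    -- `a² ≤ 8π⁴m⁴ν²E` with `ν < ν₀`, `ν₀² = a²/(8π⁴m⁴E)`: contradiction
    have h1 : z.2 ^ 2 < ν₀ ^ 2 := by nlinarith
    rw [hν₀sq, lt_div_iff₀ hrad] at h1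
    nlinarith
  · -- unresolved shear modes: the force vector vanishes on `S`, so `dissipation = power = 0`
    have hN : N < m.natAbs := not_le.1 hN
    have hS := modes_symm (d := Fin 3) N
    have hg0 : forceCoeff (modes (Fin 3) N) (shearForce m a) = 0 := by
      rw [forceCoeff_shearForce]
      funext k
      show shearCoeff m a k = 0
      refine shearCoeff_of_not_shear a ?_
      have h2 : (N : ℝ) < |(m : ℝ)| := by
        rw [← Int.cast_abs, Int.abs_eq_natAbs]; exact_mod_cast hN
      have hN0 : (0 : ℝ) ≤ N := Nat.cast_nonneg N
      rintro (hk | hk)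
      · have h : kol m ∈ modes (Fin 3) N := hk ▸ k.2
        have := freqNormSq_le_of_mem_modes h
        rw [freqNormSq_kol] at this
        nlinarith [abs_nonneg (m : ℝ), sq_abs (m : ℝ)]
      · have h : -kol m ∈ modes (Fin 3) N := hk ▸ k.2
        have := freqNormSq_le_of_mem_modes h
        rw [freqNormSq_neg, freqNormSq_kol] at this
        nlinarith [abs_nonneg (m : ℝ), sq_abs (m : ℝ)]
    have hpow := dissipation_eq_power hS (isRealCoeff_forceCoeff _
      (((isSmooth_shearForce m a).memLp 2).integrable one_le_two)) hz.1 hz.2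
    rw [hg0] at hpow
    simp only [Pi.zero_apply, inner_zero_left, Complex.zero_re, Finset.sum_const_zero] at hpow
    rw [hpow]
    exact hε

end Isolation

end Summit.AnomalousDissipation.AnomalousDissipation.Theorems.LaminarNeverLoud.Negative
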